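import Summits.QuantumFields.BalabanUV.Beta.D1BFx.AveragingJetNeedle
import Summits.QuantumFields.BalabanUV.Beta.D1BFx.RProjectorJet

/-!
# `BalabanUV.Beta.D1BFx.CornerJRankOne` — road «BF-x» for binder row D1, slot (REST′), rows A3.a′∕A3.b′, STRUCTURE ITEM (iii) of owner ruling
# ρ-g6-13 (2): THE `Q̇`-CORNER OF THE PROJECTOR JET IS RANK ONE PER BACKGROUND BOND — `Jq = (−qJet on the block of the bond) ⊗ (the `kerP`
# column of that block)`, `cornerJ = (R·G′)(needle row) ⊗ kerP-column`, with the needle letters of `AveragingJetNeedle` for the row factor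

HONEST DEPENDENCY (page 1, mandatory): continuum YM on T⁴ ⇐ BetaPertH ∧ nine spine estimates (0/9 proved); BetaPertH ⇐ (D1) ∧ (D4) ∧
CAP+tail; G-an2-4 gates asym, D1 and NE2/3/4.  HONEST FRAMING (cell contract, verbatim): «discharging `BetaPertH` makes Bałaban's UV
stability UNCONDITIONAL — a real constructive-QFT result; it is NOT the continuum limit and NOT the Clay problem.»  THIS MODULE DISCHARGES
NOTHING of the wall: [folklore] bookkeeping over leaf-07-g2's `RProjectorJet` (`Jq`, `Jq_apply`, `Jq_eq_zero_of_ne`, `RG`, `cornerJ`), leaf-09-g2's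
`RProjector` (`kerP`, `abs_kerP_le`, `cP`, `deltaP`), the typer's `GhostStencil.qJet` and this lineage's `AveragingJetNeedle` BY NAME; no `def`,
no `def … : Prop`, nothing cited, 0 sorry.  0 wall binders; NOT the (REST′) word bounds, NOT (K), NOT D1, NOT `BetaPertH`, NOT continuum, NOT Clay.

LITERAL NOTE (row-D1 owner R-D1-g25-1 ∕ road owner ρ-g7-2 (d), 2026-08-21): these are the COMB-TERM (`σ = id`) needles; for the permutation-symmetrised
literal of record `JsB12Sym` the first-order averaging jet is the `S_D`-mean of the `D!` permuted needles (linear), so every identity below applies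
summand by summand.

ABSOLUTE RULE (cell charter, verbatim): «No internally-minted statement may enter as a cited fact. Every hypothesis is either kernel-proved in
this package or a verbatim quotation of a PUBLISHED theorem with page reference. The manuscript(s) under audit are NOT citable for their own
disputed steps — they are the thing under adjudication; programme-internal (2001/route/tribunal) claims are never citable.»

WHY (owner ruling ρ-g6-13 (2) item (iii), journal 2026-08-21T00:32:44Z; this lineage's g5 BLK-NUM engines: «all growth located in `cornerJ = RG∘Jq`
on block FACES … the Jq-corner as an explicit rank-1-per-face-bond operator»).  `RProjectorJet.Jq n a κ′ u s q = −qJet n κ′ u (blk s) s · kerP (n−1) a q (blk s)`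
is guarded to the block of the bond (`Jq_eq_zero_of_ne`), so `blk s` may be frozen to `blk u`: the kernel is the tensor product of the ROW
`s ↦ −qJet n κ′ u (blk u) s` (supported on the bond's block, needle-supported with unit multiplicity and total mass `≤ n^{κ′−3}` by `AveragingJetNeedle`)
and the COLUMN `q ↦ kerP (n−1) a q (blk u)` (exponentially localised at the block, `abs_kerP_le`).  Composing with ANY fine kernel on the left
(`cornerJ G P J = (R∘G′)∘J`) keeps the rank: the `tsum` of `ExpKernelCalculus.comp` collapses to the finite block sum.

CONTENT (all [folklore]; `G P : MKer 4 Unit` arbitrary unless stated; block side `n`, `0 < a` where `kerP` is bounded):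
* §1 **`Jq_eq_row_mul_col`** — `Jq n a κ′ u s q v w = (−qJet n κ′ u (blk u) s) · kerP (n−1) a q (blk u)`.
* §2 **`cornerJ_apply_eq`** — `cornerJ G P (Jq n a κ′ u) x q v w = (−Σ_{s ∈ B(blk u)} RG G P x s v () · qJet n κ′ u (blk u) s) · kerP (n−1) a q (blk u)`;
  `trK_cornerJ_apply_eq` (the transposed corner of `rdotOf`).
* §3 letters: **`abs_row_le`** (`|Σ_{s ∈ B} RG x s · qJet … s| ≤ M · n^{κ′+1} · (n⁴)⁻¹` for any bound `M` of `|RG x ·|` on the block),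
  `abs_row_le_of_decays` (`M := C` from `Decays (RG G P) C δ′`, `0 ≤ δ′`), **`abs_cornerJ_le`** (`|cornerJ … x q| ≤ M·n^{κ′+1}·(n⁴)⁻¹ · cP·e^{−δ_P·dist(blk q, blk u)}`).
* §4 **`cornerJ_sub_trK_apply`** — the antisymmetrised corner `cornerJ − cornerJᵀ` of `rdotOf`∕`Rdot` is `−row(x)·col(q) + row(q)·col(x)` (two rank-one kernels per bond).
Provenance: D1 formalisation swarm, unit b2b-balaban-beta-d1-formalise-leaf-04 gen 6 (prover-b2b-balaban-beta-d1-formalise-leaf-04-g6-0), 2026-08-21;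
sub-leaf «D1-BFx-A3a′-NEEDLE» of `LEAVES-BFx.md`.
-/

namespace Summit.QuantumFields.BalabanUV.Beta.D1BFx.CornerJRankOne

open Finset
open scoped BigOperators
open Literature.MathematicalPhysics.QuantumFieldTheory.Balaban1983to89
open Literature.MathematicalPhysics.QuantumFieldTheory.Balaban1983to89.Beta
open B12Sec2to5 (l1 l1_nonneg)
open B6QGQLower276 (blk B mem_B)
open ExpKernelCalculus (Site MKer comp Decays)
open Summit.QuantumFields.BalabanUV.Beta.TameKernelCalculus (trK trK_apply)
open RProjector (kerP abs_kerP_le cP deltaP cP_nonneg deltaP_pos)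
open GhostStencil (qJet qJet_eq_zero)
open RProjectorJet (Jq Jq_apply Jq_eq_zero_of_ne RG cornerJ)
open AveragingJetNeedle (sum_B_abs_qJet_le)

noncomputable section

variable (n : ℕ) [NeZero n] (a : ℝ) (κ' : Fin 4) (u : Site 4)

/-! ## §1 The coarse piece is a tensor product -/

omit [NeZero n] in
/-- [folklore] **`Jq` IS RANK ONE**: `Jq n a κ′ u s q = (−qJet n κ′ u (blk u) s) · kerP (n−1) a q (blk u)` — the guard of `qJet` freezes the block
label `blk s` of the definition to the bond's block `blk u` (off that block both sides vanish). -/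
theorem Jq_eq_row_mul_col (s q : Site 4) (v w : Unit) :
    Jq n a κ' u s q v w = -(qJet n κ' u (blk (n - 1) u) s) * kerP (d := 4) (n - 1) a q (blk (n - 1) u) := by
  by_cases hs : blk (n - 1) u = blk (n - 1) s
  · rw [Jq_apply, ← hs, neg_mul]
  · rw [Jq_eq_zero_of_ne n a κ' u hs, qJet_eq_zero κ' u n (fun h => hs h.1.symm), neg_zero, zero_mul]

/-! ## §2 The `Q̇`-corner is rank one for every left factor -/

omit [NeZero n] in
/-- [folklore] Off the bond's block the row factor kills every summand of the composition. -/
theorem summand_eq_zero_of_not_mem (G P : MKer 4 Unit) (x q : Site 4) (v w : Unit) {s : Site 4} (hs : s ∉ B (n - 1) (blk (n - 1) u)) :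
    RG G P x s v () * Jq n a κ' u s q () w = 0 := by
  rw [Jq_eq_row_mul_col, qJet_eq_zero κ' u n (fun h => hs (mem_B.2 h.1)), neg_zero, zero_mul, mul_zero]

omit [NeZero n] in
/-- [folklore] **THE `Q̇`-CORNER IS RANK ONE PER BOND**: for ANY fine kernels `G`, `P`,
`cornerJ G P (Jq n a κ′ u) x q = (−Σ_{s ∈ B(blk u)} (R∘G′)(x,s) · qJet n κ′ u (blk u) s) · kerP (n−1) a q (blk u)` — the `tsum` of the composition
collapses to the bond's block, and the `q`-dependence factors through the `kerP` column of that block. -/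
theorem cornerJ_apply_eq (G P : MKer 4 Unit) (x q : Site 4) (v w : Unit) :
    cornerJ G P (Jq n a κ' u) x q v w =
      -(∑ s ∈ B (n - 1) (blk (n - 1) u), RG G P x s v () * qJet n κ' u (blk (n - 1) u) s) * kerP (d := 4) (n - 1) a q (blk (n - 1) u) := by
  unfold cornerJ comp
  simp only [Finset.univ_unique, PUnit.default_eq_unit, Finset.sum_singleton]
  rw [tsum_eq_sum (s := B (n - 1) (blk (n - 1) u)) (fun s hs => summand_eq_zero_of_not_mem n a κ' u G P x q v w hs)]
  simp only [Jq_eq_row_mul_col, neg_mul, mul_neg, Finset.sum_neg_distrib, ← mul_assoc, ← Finset.sum_mul]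

omit [NeZero n] in
/-- [folklore] The transposed corner (the fourth term of `RProjectorJet.rdotOf`): `(cornerJ …)ᵀ(q, x) = cornerJ … x q`, same rank-one form. -/
theorem trK_cornerJ_apply_eq (G P : MKer 4 Unit) (x q : Site 4) (v w : Unit) :
    trK (cornerJ G P (Jq n a κ' u)) q x w v =
      -(∑ s ∈ B (n - 1) (blk (n - 1) u), RG G P x s v () * qJet n κ' u (blk (n - 1) u) s) * kerP (d := 4) (n - 1) a q (blk (n - 1) u) := by
  rw [trK_apply, cornerJ_apply_eq]

/-! ## §3 Letters: the row factor carries the needle weight `n^{κ′−3}`, the column the block localisation of `kerP` -/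

/-- [folklore] **THE ROW-FACTOR LETTER**: if `|(R∘G′)(x,s)| ≤ M` on the bond's block then
`|Σ_{s ∈ B} (R∘G′)(x,s) · qJet n κ′ u (blk u) s| ≤ M · n^{κ′+1} · (n⁴)⁻¹` (`AveragingJetNeedle.sum_B_abs_qJet_le`). -/
theorem abs_row_le (G P : MKer 4 Unit) (x : Site 4) (v : Unit) {M : ℝ}
    (hM : ∀ s ∈ B (n - 1) (blk (n - 1) u), |RG G P x s v ()| ≤ M) :
    |∑ s ∈ B (n - 1) (blk (n - 1) u), RG G P x s v () * qJet n κ' u (blk (n - 1) u) s|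
      ≤ M * ((n : ℝ) ^ ((κ' : ℕ) + 1) * ((n : ℝ) ^ 4)⁻¹) := by
  have hM0 : 0 ≤ M := by
    have hu : u ∈ B (n - 1) (blk (n - 1) u) := mem_B.2 rfl
    exact (abs_nonneg _).trans (hM u hu)
  calc |∑ s ∈ B (n - 1) (blk (n - 1) u), RG G P x s v () * qJet n κ' u (blk (n - 1) u) s|
      ≤ ∑ s ∈ B (n - 1) (blk (n - 1) u), |RG G P x s v () * qJet n κ' u (blk (n - 1) u) s| := Finset.abs_sum_le_sum_abs _ _
    _ ≤ ∑ s ∈ B (n - 1) (blk (n - 1) u), M * |qJet n κ' u (blk (n - 1) u) s| := by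
        refine Finset.sum_le_sum fun s hs => ?_
        rw [abs_mul]
        exact mul_le_mul_of_nonneg_right (hM s hs) (abs_nonneg _)
    _ = M * ∑ s ∈ B (n - 1) (blk (n - 1) u), |qJet n κ' u (blk (n - 1) u) s| := by rw [Finset.mul_sum]
    _ ≤ M * ((n : ℝ) ^ ((κ' : ℕ) + 1) * ((n : ℝ) ^ 4)⁻¹) :=
        mul_le_mul_of_nonneg_left (sum_B_abs_qJet_le n κ' u (blk (n - 1) u)) hM0

/-- [folklore] The same with the bound read off an exponential-decay socket of `R∘G′` (`RProjectorJet.decays_RG`): `Decays (RG G P) C δ′`, `0 ≤ δ′`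
⟹ `|row| ≤ C · n^{κ′+1} · (n⁴)⁻¹`. -/
theorem abs_row_le_of_decays (G P : MKer 4 Unit) (x : Site 4) (v : Unit) {C δ' : ℝ} (hRG : Decays (RG G P) C δ') (hδ' : 0 ≤ δ') :
    |∑ s ∈ B (n - 1) (blk (n - 1) u), RG G P x s v () * qJet n κ' u (blk (n - 1) u) s|
      ≤ C * ((n : ℝ) ^ ((κ' : ℕ) + 1) * ((n : ℝ) ^ 4)⁻¹) := by
  refine abs_row_le n κ' u G P x v fun s _ => (hRG x s v ()).trans ?_
  have hC : 0 ≤ C := by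
    have h := hRG x s v ()
    have hE : 0 < Real.exp (-δ' * l1 (x - s)) := Real.exp_pos _
    nlinarith [abs_nonneg (RG G P x s v ())]
  have hE1 : Real.exp (-δ' * l1 (x - s)) ≤ 1 := by
    rw [Real.exp_le_one_iff]
    nlinarith [l1_nonneg (x - s)]
  nlinarith

/-- [folklore] **THE CORNER-ENTRY LETTER**: `|cornerJ G P (Jq n a κ′ u) x q| ≤ M · n^{κ′+1}·(n⁴)⁻¹ · cP·e^{−δ_P·dist(blk q, blk u)}` for `0 < a` and any bound `M`
of `|(R∘G′)(x, ·)|` on the bond's block — the needle weight of the row times the block localisation of the `kerP` column. -/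
theorem abs_cornerJ_le (ha : 0 < a) (G P : MKer 4 Unit) (x q : Site 4) (v w : Unit) {M : ℝ}
    (hM : ∀ s ∈ B (n - 1) (blk (n - 1) u), |RG G P x s v ()| ≤ M) :
    |cornerJ G P (Jq n a κ' u) x q v w|
      ≤ M * ((n : ℝ) ^ ((κ' : ℕ) + 1) * ((n : ℝ) ^ 4)⁻¹) *
          (cP 4 (n - 1) a * Real.exp (-(deltaP 4 a * dist (blk (n - 1) q) (blk (n - 1) u)))) := by
  rw [cornerJ_apply_eq, abs_mul, abs_neg]
  exact mul_le_mul (abs_row_le n κ' u G P x v hM) (abs_kerP_le (d := 4) (n - 1) ha q (blk (n - 1) u)) (abs_nonneg _)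
    ((abs_nonneg _).trans (abs_row_le n κ' u G P x v hM))

/-! ## §4 The antisymmetrised `Q̇`-corner of `Rdot` -/

omit [NeZero n] in
/-- [folklore] **THE ANTISYMMETRISED `Q̇`-CORNER** (the term `cornerJ − cornerJᵀ` of `RProjectorJet.rdotOf`, hence of `Rdot n a cK cQ κ′ u` with
`G := Ggh n a`, `P := Pgt n a`) entrywise: `−row(x)·col(q) + row(q)·col(x)` with `row(x) = Σ_{s ∈ B(blk u)} (R∘G′)(x,s)·qJet n κ′ u (blk u) s` and
`col(q) = kerP (n−1) a q (blk u)` — a sum of two rank-one kernels per background bond. -/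
theorem cornerJ_sub_trK_apply (G P : MKer 4 Unit) (x q : Site 4) (v w : Unit) :
    (cornerJ G P (Jq n a κ' u) - trK (cornerJ G P (Jq n a κ' u))) x q v w =
      -(∑ s ∈ B (n - 1) (blk (n - 1) u), RG G P x s v () * qJet n κ' u (blk (n - 1) u) s) * kerP (d := 4) (n - 1) a q (blk (n - 1) u)
        + (∑ s ∈ B (n - 1) (blk (n - 1) u), RG G P q s w () * qJet n κ' u (blk (n - 1) u) s) * kerP (d := 4) (n - 1) a x (blk (n - 1) u) := by
  show cornerJ G P (Jq n a κ' u) x q v w - trK (cornerJ G P (Jq n a κ' u)) x q v w = _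
  rw [trK_apply, cornerJ_apply_eq, cornerJ_apply_eq]
  ring

end

end Summit.QuantumFields.BalabanUV.Beta.D1BFx.CornerJRankOne
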